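import Literature.MathematicalPhysics.QuantumFieldTheory.Balaban1983to89.T4BetaMemory

/-!
# `Balaban1983to89.T4TwoRunMatching` — node U2 / estimate NE4 by TWO-TRAJECTORY COMPARISON (cell `pub-balaban`,
T4-DAG §2 U2 / §5 row T4-U2.E / §6 NE4; unit `b2b-balaban-t4-ne4-p2`, technique P2): the couplings of the two runs at
spacings ε = L^{−K} and ε/L are matched SCALE BY SCALE together with their brackets — a joint two-point boundary-value
system (backward coupling discrepancy, forward bracket discrepancy with fading memory) solved by ONE weighted-maximum
fixed point; the β sub-cell's (AF-0r) rate is the named input, the β¹-mismatch rate and the K-uniform matching rate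
`T4CauchySum.InjectedRate` are the outputs (bookkeeping; `FlowStep` vocabulary)

HONEST FRAMING (T4-DAG PAGE 1).  The cell's T4 target is rung (B)+1 of its ladder: existence AND uniqueness of the
continuum limit of Bałaban's unit-scale expectations on a FINITE four-torus — a constructive-QFT statement strictly
beyond ultraviolet stability (Theorems 1–3 of [I]); it is NOT infinite volume, NOT the Yang–Mills mass gap and NOT the
Clay problem.  This module ASSERTS NOTHING about Bałaban's β-functions or effective actions: every `def … : Prop` below
is a HYPOTHESIS SHAPE (the typing of an estimate that is NOT in print), consumed only as a binder, and every theorem is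
elementary real analysis (finite sums, the backward geometric accumulation and the forward renewal inequality of the
imported modules, one weighted-maximum fixed point).  CONDITIONALS BY NAME, never hidden: the (AF-0r) input
`hconv : ∀ k, |S.β0 k − β∞| ≤ c₀ρ^k` is the field `conv` of the β sub-cell's `Beta.Assembly.LimitForm` — the (AF-0r)
member of its hypothesis package BetaPertH, NOT discharged for Bałaban's β (discharged only in sibling models) — and is an
explicit binder of every theorem that uses it; the existence of the two infrared-pinned runs inside the box ]0, γ]
(binders `hA hB hAbox hBbox hpin`) is node U1/H3 of the spine (`FlowStep.Tuned`, conditional there on the (B)/(B^μ)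
lower-bound input) and is likewise only a binder here, never constructed.  Value = the assigned technique's located
estimate typed as Lean `Prop`s + kernel bookkeeping of «named inputs ⇒ K-uniform matching rate»; NOT summit progress.

CITATION HEADER (lean-in-tree rule 2026-08-18).  T. Bałaban, *Renormalization group approach to lattice gauge field
theories. I*, Commun. Math. Phys. **109** (1987) 249–301 [Balaban1987RG1] (cell paper B12 = [I]; journal page = PDF
page + 248); T. Bałaban, *Convergent renormalization expansions for lattice gauge theories*, Commun. Math. Phys. **119**
(1988) 243–285 [Balaban1988Convergent] ([III]).  The manuscripts are UNDER ADJUDICATION: quoted for what they STATE,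
never as establishing a disputed step.  Page 268 [PDF 20] of [I] was read by this seat on the render
`b2b-balaban-ref1/pages/1987-cmp109-rg-I-small-field/…-p020-x2.png`; the p. 256 / p. 264 / p. 298 loci of [I] and
(2.43) of [III] are those ALREADY quoted verbatim in the imported modules `T4CouplingMatching` (header; loci (Q2), (Q5),
(Q8) of the node's cross-read `t4/T4-XREAD-U2.md`) and `T4BetaMemory` (header) and are repeated from there — nothing
else is newly quoted.
* [I] p. 268 (2.12)–(2.15): the new action A_{k+1}(U_{k+1}) of (2.12) is −(1/g_k²)A(U_{k+1}) + E_k(U_{k+1}) +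
  [log Z^{(k)}(U_{k+1}) − log Z^{(k)}(1)] + the logarithm of a fluctuation integral every term of which carries the
  rescaled field g_kCB, its last term being the curly bracket "{E_k(U_k(exp i[g_kCB − hD̃(g_kCB)]V^{(k)})) −
  E_k(U_k(V^{(k)}))}"; "The integral in (2.12) defines the new term E^{(k+1)} in the inductive definition of the action
  A_{k+1} by the formula E^{(k+1)}(g_k, U_{k+1}) = log ∫dμ_{C^{(k)}}(B)χ_k exp[P^{(k)}(g_k, U_{k+1}, B) + {…}]. (2.13)
  Let us remark that the expression under the exponential above vanishes at g_k = 0, and log N″_k = E^{(k+1)}(g_k, 1).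
  (2.14) Finally we perform the coupling constant renormalization 1/g_k² = 1/g²_{k+1} + β_{k+1}(g_k) (2.15) with the
  β-function defined by the formulas (1.20), (1.22) for j = k."
* [I] p. 256 (0.20) "1/g_k² = 1/g²_{k+1} + β_{k+1}(g_k)" with the unit-scale index K, "hence ε = L^{−K}, and the sequence
  of actions and coupling constants is defined for k = 0, 1, ..., K" (tree `FlowStep.RGEqH`); (0.23) "E_k(U_k) =
  Σ_{j=1}^{k} [−β_j(g_{j−1})A^η(U_k) + E^{(j)}(U_k)]" (the BRACKETS); p. 264 (1.20)/(1.22): β_{j+1}(g_j) is read off the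
  new term E^{(j+1)}(g_j, ·) through its vacuum-polarization kernel and the second moment (tree `B12Beta`); p. 298 "We
  write β_j as explicitly dependent on g_{j−1}, although it depends also on all preceding coupling constants." (tree
  `FlowStep.HBeta`: `β k v = β_{k+1}(g_0, …, g_k)`).
* [III] Theorem 2 (2.43) p. 263 (quoted in `T4BetaMemory`): the only printed contraction of old-scale content — a SIZE
  bound carrying the factor (L^{−β})^{n−j}; the printed TYPE of a fading memory, not a modulus.
STRUCTURAL READING used below ([analysis] of the displayed (2.12)/(2.13), as in `T4BetaMemory`): the step-(k+1) output
E^{(k+1)} — hence β_{k+1} — depends on (i) the step's explicit objects (C^{(k)}, χ_k, H₁, Δ₁, G₃, V, D̃: functions of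
the number k of scales already integrated, i.e. of η = L^{−k} at fixed unit scale), (ii) the LAST coupling g_k,
explicitly, and (iii) everything older ONLY through the previous action E_k inside the curly bracket, i.e. through the
brackets of (0.23).
WHAT IS NOT PRINTED anywhere in [I], [Balaban1988RG2Cluster], [III] (cell cross-reads `t4/T4-XREAD-U2.md` §3 verdict NO,
`t4/T4-XREAD-U2R2.md` §0/§2 (N1)–(N4); GAPS G-t4-U2-1, G-t4-U2-2, G-t4-U2R-1…-4, G-b12g8-1, G-b12g8-2): any dependence of β_{k+1} or
E^{(k+1)} on k beyond "defined for each k"; any comparison of objects built at two lattice spacings (cell NE2/NE3/NE5);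
any modulus of continuity of one renormalization step in the previous action or in g_k, and any fading of such a
modulus with the age — [III] p. 262 names the map-between-spaces formulation and sets it aside ("This generalization
does not seem to be useful, or interesting now.").  Hence §3's predicates are HYPOTHESES; the cell record
`t4/T4-EST-NE4-P2.md` carries the paper-level attempt, the first non-printed step typed, and GAPS rows G-ne4p2-1, G-ne4p2-2.

THE MODELLING POINT (two-trajectory comparison; cell T4-DAG §1 D3, §2 U2).  Run A = K steps of (0.20) from ε = L^{−K},
run B = K + 1 steps from ε/L, ONE family `β : FlowStep.HBeta` for both (its k-dependence IS the η-dependence, p. 264 /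
p. 298), infrared pin g^A_K = g^B_{K+1}; A's scale j is partnered with B's scale j + 1 (as in `T4CouplingMatching`).
TWO discrepancy profiles are matched SIMULTANEOUSLY:
  δ_j = `disc gA gB j` = |1/(g^A_j)² − 1/(g^B_{j+1})²|  (couplings; δ_K = 0 by the pin — known at the INFRARED end);
  s_j ≥ 0, j < K — a majorant of the discrepancy of the j-th MATCHED PAIR of brackets of (0.23): A's bracket born at
  A-step j + 1 (it sees g^A_j explicitly, (ii)) and B's born at B-step j + 2 (sees g^B_{j+1}), measured after transport
  to every later scale in a norm controlling the read-out (1.20)/(1.22); B's finest bracket (born at B-step 1) has no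
  partner.  `s` is DATA of the hypotheses: this module defines no norm on activities.
(0.20) for both runs gives the RAW backward step (kernel, `disc_step_twoRun`): δ_j ≤ δ_{j+1} + m_j with
m_j = |β_{j+2}(g^B_0, …, g^B_{j+1}) − β_{j+1}(g^A_0, …, g^A_j)| = `betaMismatch β gA gB j`, the FULL two-run β-mismatch —
NOT split into «scale shift at fixed couplings + history shift at fixed scale» (contrast `T4CouplingMatching.disc_step`,
which inserts the intermediate history `Fin.tail w` and needs BOX-UNIFORM moduli for both halves).  The printed one-loop
split `B12Beta.OneLoopSplit` with (AF-0r) gives m_j ≤ 2c₀ρ^j + m¹_j (`betaMismatch_le_split`), m¹_j = `remMismatch` =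
the β¹-MISMATCH of the two runs.  The structural reading (i)–(iii) types the technique's two located estimates:
  READ-OUT `TwoRunReadOut S r gA gB s K`:   m¹_j ≤ r·s_j   (β¹ of the new bracket is a linear functional of it);
  RENEWAL  `TwoRunRenewal a ℓ' ρ M gA gB s K`:   s_j ≤ a ρ^j + ℓ'·|g^A_j − g^B_{j+1}| + Σ_{i<j} M_{j,i} s_i
  — source (i) at a geometric η-rate (cell NE2/NE3; it also carries B's unpartnered finest bracket, whose influence is a
  source fading with the age), the coupling discrepancy injected ONCE, at birth (ii), and the older pairs through a memory
  M (iii) with `T4CouplingMatching.FadingMemory C ω M`, (1 + C)ω < ρ < 1 (the MODULUS form of a (2.43)-type contraction: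
  `T4BetaMemory`'s located input, here ALONG THE TWO RUNS only).
Since |g − g′| ≤ g²g′·|1/g² − 1/g′²| (`abs_sub_le_of_inv_sq`), the birth term is ≤ ℓ'γ³·δ_j: the system is TWO-SIDED (δ
flows backward from the pin, s forward from the ultraviolet end) and closes by one weighted-maximum fixed point under the
pure γ-window r·ℓ'γ³·κ ≤ (1 − ρ)/2, κ = (ρ − ω)/(ρ − (1 + C)ω) (§1) — no asymptotic-freedom weight sum and no
`EventualLowerH` (contrast `T4CouplingMatching` §4), because the memory contracts strictly faster than the target rate.

WHAT IS KERNEL-CHECKED.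
§1 `twoPoint_fixedPoint` — the abstract joint system over real sequences: δ_K = 0, δ_j ≤ δ_{j+1} + pρ^j + q s_j,
   s_j ≤ aρ^j + e_j δ_j + Σ_{i<j} M_{j,i} s_i, 0 ≤ e_j ≤ ē, M_{j,i} ≤ Cω^{j−i}, (1 + C)ω < ρ < 1, qēκ ≤ (1 − ρ)/2
   ⇒ δ_j ≤ 2(p + qaκ)(1 − ρ)⁻¹ρ^j (j ≤ K) and s_j ≤ (a + ē·2(p + qaκ)(1 − ρ)⁻¹)κρ^j (j < K), constants free of K
   (`T4BetaMemory.renewal_geometric` on the truncated s + `T4CouplingMatching.backward_geom` + absorption at the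
   maximiser of δ_j/ρ^j).
§2 the two-run vocabulary: `betaMismatch`, `remMismatch`, `disc_step_twoRun` ((0.20) twice), `betaMismatch_le_split`
   (one-loop split + (AF-0r)).
§3 the located estimates TYPED — `TwoRunReadOut`, `TwoRunRenewal` — and the assembly: `disc_le_of_twoRun` (both rates
   for one pair of runs), `betaMismatch_rate_of_twoRun` (THE β¹-MISMATCH RATE m¹_j ≤ r·D_s·ρ^j and the full mismatch
   rate — the two-run forms of `RemainderShiftRate` / `ScaleShiftRate` along the runs, which is all node U2 consumes),
   `injectedRate_of_twoRun_runs` (family over K ⇒ `T4CauchySum.InjectedRate D_δ 0 ρ`, node U2's output), and the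
   degenerate consistency check `disc_le_of_pureOneLoop` (β¹ ≡ 0 ⇒ matching from (AF-0r) alone at rate 4c₀(1 − ρ)⁻¹ρ^j:
   the joint system collapses to `backward_geom`).
COMPARISON WITH THE BOX-UNIFORM TYPING (`T4CouplingMatching` §1/§3 + `T4BetaMemory` §3/§4, lineages pv16 / pv20; words
only, no theorem): there NE4 = `ScaleShiftRate` (uniform on the box ]0, γ]^{k+2}) + `HistLipschitz`/`FadingMemory`
moduli (uniform on Box × Box), and `T4BetaMemory` reduces them to TWO renewal systems (data, moduli) over one unprinted
functional memory; here ONE renewal system along the two ACTUAL runs (two-point hypotheses), the coupling discrepancy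
riding inside the bracket discrepancy, the β-mismatch never split by an intermediate history.  Neither typing is
printed and neither shape implies the other; both locate the same residual (a modulus-with-memory of one renormalization
step).  This one is the literal two-lattice comparison of the cell's technique P2; the sibling seat P1
(`b2b-balaban-t4-ne4-p1`, size-to-memory Grönwall on ONE history) is a different technique and is not used.

NEW module of unit `b2b-balaban-t4-ne4-p2` (planner seat, NE4 technique P2; journal claim T4-U2.NE4-PROVE-P2*,
2026-08-19); imports `T4BetaMemory` (hence `T4CouplingMatching`, `FlowStep`, `B12Beta`, `T4CauchySum`) and modifies
nothing; no `sorry`, no `axiom`.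
-/

namespace Literature.MathematicalPhysics.QuantumFieldTheory.Balaban1983to89.T4TwoRunMatching

open Literature.MathematicalPhysics.QuantumFieldTheory.Balaban1983to89
open Literature.MathematicalPhysics.QuantumFieldTheory.Balaban1983to89.FlowStep
open Literature.MathematicalPhysics.QuantumFieldTheory.Balaban1983to89.T4CouplingMatching
open Literature.MathematicalPhysics.QuantumFieldTheory.Balaban1983to89.T4BetaMemory
open Finset

/-! ## §1 The joint two-point boundary-value system (kernel-checked arithmetic) -/

/-- **THE TWO-POINT FIXED POINT.**  Real sequences `δ ≥ 0` (pinned: `δ K = 0`, backward step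
`δ_j ≤ δ_{j+1} + pρ^j + q·s_j` for `j < K`) and `s` (`s_j ≥ 0` and forward renewal
`s_j ≤ aρ^j + e_j·δ_j + Σ_{i<j} M_{j,i}·s_i` for `j < K`, weights `0 ≤ e_j ≤ ē`, memory `0 ≤ M_{j,i} ≤ Cω^{j−i}`) with
`(1 + C)ω < ρ < 1` and the loop gain `q·ē·κ ≤ (1 − ρ)/2`, `κ = (ρ − ω)/(ρ − (1 + C)ω)`, satisfy
`δ_j ≤ 2(p + qaκ)(1 − ρ)⁻¹·ρ^j` for `j ≤ K` and `s_j ≤ (a + ē·2(p + qaκ)(1 − ρ)⁻¹)·κ·ρ^j` for `j < K` — constants free of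
`K`.  Proof: with `D = max_{i≤K} δ_i/ρ^i` the truncated `s` obeys a renewal with sources `(a + ēD)ρ^j`, so
`s_j ≤ (a + ēD)κρ^j` (`renewal_geometric`); then `backward_geom` gives `δ_j ≤ (p + q(a + ēD)κ)(1 − ρ)⁻¹ρ^j`, and at the
maximiser the gain hypothesis absorbs `D`. [folklore] -/
theorem twoPoint_fixedPoint {K : ℕ} {δ s e : ℕ → ℝ} {M : ℕ → ℕ → ℝ} {a p q ē C ω ρ : ℝ}
    (hρ1 : ρ < 1) (hω : 0 ≤ ω) (hC : 0 ≤ C) (hsmall : (1 + C) * ω < ρ)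
    (ha : 0 ≤ a) (hp : 0 ≤ p) (hq : 0 ≤ q) (hē : 0 ≤ ē)
    (hδ : ∀ j, 0 ≤ δ j) (hs : ∀ j, j < K → 0 ≤ s j) (he : ∀ j, j < K → 0 ≤ e j ∧ e j ≤ ē)
    (hM : ∀ j i, i < j → 0 ≤ M j i ∧ M j i ≤ C * ω ^ (j - i))
    (hK : δ K = 0)
    (hback : ∀ j, j < K → δ j ≤ δ (j + 1) + p * ρ ^ j + q * s j)
    (hfwd : ∀ j, j < K → s j ≤ a * ρ ^ j + e j * δ j + ∑ i ∈ range j, M j i * s i)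
    (hgain : q * ē * ((ρ - ω) / (ρ - (1 + C) * ω)) ≤ (1 - ρ) / 2) :
    (∀ j, j ≤ K → δ j ≤ 2 * (p + q * a * ((ρ - ω) / (ρ - (1 + C) * ω))) / (1 - ρ) * ρ ^ j) ∧
    (∀ j, j < K → s j ≤ (a + ē * (2 * (p + q * a * ((ρ - ω) / (ρ - (1 + C) * ω))) / (1 - ρ)))
      * ((ρ - ω) / (ρ - (1 + C) * ω)) * ρ ^ j) := by
  set κ := (ρ - ω) / (ρ - (1 + C) * ω) with hκ
  have h1Cω : 0 ≤ (1 + C) * ω := by positivity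
  have hρ0 : 0 < ρ := lt_of_le_of_lt h1Cω hsmall
  have hωρ : ω < ρ := by nlinarith
  have hden : 0 < ρ - (1 + C) * ω := sub_pos.mpr hsmall
  have hκ0 : 0 ≤ κ := div_nonneg (sub_pos.mpr hωρ).le hden.le
  have h1ρ : 0 < 1 - ρ := sub_pos.mpr hρ1
  -- the weighted maximum of δ over j ≤ K
  have hne : (range (K + 1)).Nonempty := ⟨0, by simp⟩
  set D := (range (K + 1)).sup' hne (fun i => δ i / ρ ^ i) with hD
  have hDi : ∀ i, i ≤ K → δ i ≤ D * ρ ^ i := by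
    intro i hi
    have h : δ i / ρ ^ i ≤ D :=
      Finset.le_sup' (fun i => δ i / ρ ^ i) (Finset.mem_range.mpr (Nat.lt_succ_of_le hi))
    rwa [div_le_iff₀ (pow_pos hρ0 i)] at h
  have hD0 : 0 ≤ D := by
    have h : δ 0 / ρ ^ 0 ≤ D :=
      Finset.le_sup' (fun i => δ i / ρ ^ i) (Finset.mem_range.mpr (Nat.succ_pos K))
    have : (0 : ℝ) ≤ δ 0 / ρ ^ 0 := by simpa using hδ 0
    exact this.trans h
  -- Step 1: forward renewal of the truncated bracket discrepancies, sources (a + ē D) ρ^j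
  set A := a + ē * D with hA
  have hA0 : 0 ≤ A := by positivity
  set s' : ℕ → ℝ := fun j => if j < K then s j else 0 with hs'
  have hs'K : ∀ j, j < K → s' j = s j := fun j hj => by simp [hs', hj]
  have hs'0 : ∀ j, 0 ≤ s' j := by
    intro j
    by_cases hj : j < K
    · rw [hs'K j hj]; exact hs j hj
    · simp [hs', hj]
  have hrec' : ∀ j, s' j ≤ A * ρ ^ j + ∑ i ∈ range j, M j i * s' i := by
    intro j
    have hsum0 : 0 ≤ ∑ i ∈ range j, M j i * s' i :=
      Finset.sum_nonneg fun i hi => mul_nonneg (hM j i (mem_range.mp hi)).1 (hs'0 i)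
    by_cases hj : j < K
    · have h1 := hfwd j hj
      have h2 : e j * δ j ≤ ē * (D * ρ ^ j) := mul_le_mul (he j hj).2 (hDi j hj.le) (hδ j) hē
      have h3 : ∑ i ∈ range j, M j i * s i = ∑ i ∈ range j, M j i * s' i :=
        Finset.sum_congr rfl fun i hi => by rw [hs'K i (lt_trans (mem_range.mp hi) hj)]
      rw [hs'K j hj, ← h3]
      calc s j ≤ a * ρ ^ j + e j * δ j + ∑ i ∈ range j, M j i * s i := h1
        _ ≤ a * ρ ^ j + ē * (D * ρ ^ j) + ∑ i ∈ range j, M j i * s i := by linarith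
        _ = A * ρ ^ j + ∑ i ∈ range j, M j i * s i := by rw [hA]; ring
    · have h4 : s' j = 0 := by simp [hs', hj]
      rw [h4]
      have : 0 ≤ A * ρ ^ j := mul_nonneg hA0 (pow_nonneg hρ0.le j)
      linarith
  have hsbound := renewal_geometric hA0 hC hω hsmall hM hrec'
  have hsj : ∀ j, j < K → s j ≤ A * κ * ρ ^ j := by
    intro j hj
    have h := hsbound j
    rw [hs'K j hj] at h
    calc s j ≤ A * (ρ - ω) / (ρ - (1 + C) * ω) * ρ ^ j := h
      _ = A * κ * ρ ^ j := by rw [hκ]; ring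
  -- Step 2: backward accumulation from the pin
  have hB0 : 0 ≤ p + q * (A * κ) := by positivity
  have hback' : ∀ j, j < K → δ j ≤ δ (j + 1) + (p + q * (A * κ)) * ρ ^ j := by
    intro j hj
    have h1 := hback j hj
    have h2 : q * s j ≤ q * (A * κ * ρ ^ j) := mul_le_mul_of_nonneg_left (hsj j hj) hq
    calc δ j ≤ δ (j + 1) + p * ρ ^ j + q * s j := h1
      _ ≤ δ (j + 1) + p * ρ ^ j + q * (A * κ * ρ ^ j) := by linarith
      _ = δ (j + 1) + (p + q * (A * κ)) * ρ ^ j := by ring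
  have hδb := backward_geom hρ0.le hρ1 hB0 (le_of_eq hK) hback'
  -- Step 3: absorption at the maximiser
  obtain ⟨i₀, hi₀, hDi₀⟩ := Finset.exists_mem_eq_sup' hne (fun i => δ i / ρ ^ i)
  have hi₀K : i₀ ≤ K := Nat.lt_succ_iff.mp (Finset.mem_range.mp hi₀)
  have hDle : D ≤ (p + q * (A * κ)) / (1 - ρ) := by
    calc D = δ i₀ / ρ ^ i₀ := hDi₀
      _ ≤ (p + q * (A * κ)) / (1 - ρ) := by
          rw [div_le_iff₀ (pow_pos hρ0 i₀)]
          exact hδb i₀ hi₀K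
  have hDle' : D * (1 - ρ) ≤ p + q * (A * κ) := (le_div_iff₀ h1ρ).mp hDle
  have hDexp : D * (1 - ρ) ≤ p + q * a * κ + q * ē * κ * D := by
    have e1 : p + q * (A * κ) = p + q * a * κ + q * ē * κ * D := by rw [hA]; ring
    linarith [hDle', e1]
  have hgain' : q * ē * κ * D ≤ (1 - ρ) / 2 * D := mul_le_mul_of_nonneg_right hgain hD0
  have hDfin : D ≤ 2 * (p + q * a * κ) / (1 - ρ) := by
    rw [le_div_iff₀ h1ρ]
    linarith [hDexp, hgain']
  -- Step 4: read off both bounds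
  refine ⟨fun j hj => (hDi j hj).trans (mul_le_mul_of_nonneg_right hDfin (pow_nonneg hρ0.le j)),
    fun j hj => ?_⟩
  have hAle : A * κ ≤ (a + ē * (2 * (p + q * a * κ) / (1 - ρ))) * κ := by
    refine mul_le_mul_of_nonneg_right ?_ hκ0
    rw [hA]
    linarith [mul_le_mul_of_nonneg_left hDfin hē]
  calc s j ≤ A * κ * ρ ^ j := hsj j hj
    _ ≤ (a + ē * (2 * (p + q * a * κ) / (1 - ρ))) * κ * ρ ^ j :=
        mul_le_mul_of_nonneg_right hAle (pow_nonneg hρ0.le j)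

/-! ## §2 Two infrared-pinned runs: the raw backward step and the one-loop split of the β-mismatch -/

/-- The FULL β-MISMATCH of the two runs at the partnered scales (A's step j + 1 uses `β j` on the history
`(g^A_0, …, g^A_j)`, B's step j + 2 uses `β (j+1)` on `(g^B_0, …, g^B_{j+1})`):
`m_j = |β_{j+2}(g^B_0, …, g^B_{j+1}) − β_{j+1}(g^A_0, …, g^A_j)|`.  Not split into scale shift + history shift.
[cite: Balaban1987RG1, (0.20) p.256 and §5 p.298] -/
noncomputable def betaMismatch (β : HBeta) (gA gB : ℕ → ℝ) (j : ℕ) : ℝ :=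
  |β (j + 1) (prefixOf gB (j + 1)) - β j (prefixOf gA j)|

/-- The β¹-MISMATCH of the two runs: the same difference for the remainder `β¹` of the printed one-loop split
`β = β⁰ + β¹` (`B12Beta.OneLoopSplit`; β⁰ history-free).  This is the quantity the technique bounds.
[cite: Balaban1987RG1, (1.20)-(1.22) p.264 and (2.15) p.268] -/
noncomputable def remMismatch {β : HBeta} (S : B12Beta.OneLoopSplit β) (gA gB : ℕ → ℝ) (j : ℕ) : ℝ :=
  |S.β1 (j + 1) (prefixOf gB (j + 1)) - S.β1 j (prefixOf gA j)|

/-- `betaMismatch ≥ 0`. [folklore] -/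
theorem betaMismatch_nonneg (β : HBeta) (gA gB : ℕ → ℝ) (j : ℕ) : 0 ≤ betaMismatch β gA gB j := abs_nonneg _

/-- `remMismatch ≥ 0`. [folklore] -/
theorem remMismatch_nonneg {β : HBeta} (S : B12Beta.OneLoopSplit β) (gA gB : ℕ → ℝ) (j : ℕ) :
    0 ≤ remMismatch S gA gB j := abs_nonneg _

/-- THE RAW BACKWARD STEP ((0.20) for both runs, subtracted): for `j < K`,
`disc gA gB j ≤ disc gA gB (j+1) + betaMismatch β gA gB j` — run A's step j (`β j` at `(g^A_0..g^A_j)`) against run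
B's step j + 1 (`β (j+1)` at `(g^B_0..g^B_{j+1})`).  No box, no modulus: pure algebra of (0.20).
[cite: Balaban1987RG1, (0.20) p.256] -/
theorem disc_step_twoRun {β : HBeta} {K : ℕ} {gA gB : ℕ → ℝ} (hA : RGEqH K β gA) (hB : RGEqH (K + 1) β gB)
    {j : ℕ} (hj : j < K) : disc gA gB j ≤ disc gA gB (j + 1) + betaMismatch β gA gB j := by
  have eA := hA j hj
  have eB := hB (j + 1) (by omega)
  have key : 1 / gA j ^ 2 - 1 / gB (j + 1) ^ 2
      = (1 / gA (j + 1) ^ 2 - 1 / gB (j + 1 + 1) ^ 2)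
        - (β (j + 1) (prefixOf gB (j + 1)) - β j (prefixOf gA j)) := by
    rw [eA, eB]; ring
  simp only [disc, betaMismatch]
  rw [key]
  exact abs_sub _ _

/-- ONE-LOOP SPLIT OF THE MISMATCH: with the printed split `β = β⁰ + β¹` (`B12Beta.OneLoopSplit S`) and the β
sub-cell's (AF-0r) rate `|β⁰_{k+1} − β⁰_∞| ≤ c₀ρ^k` (the field `Beta.Assembly.LimitForm.conv` — a NAMED member of
BetaPertH, taken as the binder `hconv`, never asserted), `betaMismatch ≤ 2c₀ρ^j + remMismatch`: the history-free halves
differ by at most `c₀ρ^{j+1} + c₀ρ^j`.  The two-run analogue of `T4CouplingMatching.scaleShiftRate_of_split`.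
[cite: Balaban1987RG1, (1.22) p.264 and (2.15) p.268] -/
theorem betaMismatch_le_split {β : HBeta} (S : B12Beta.OneLoopSplit β) {binf c₀ ρ : ℝ}
    (hρ0 : 0 ≤ ρ) (hρ1 : ρ ≤ 1) (hc₀ : 0 ≤ c₀) (hconv : ∀ k, |S.β0 k - binf| ≤ c₀ * ρ ^ k)
    (gA gB : ℕ → ℝ) (j : ℕ) :
    betaMismatch β gA gB j ≤ 2 * c₀ * ρ ^ j + remMismatch S gA gB j := by
  have h1 := hconv (j + 1)
  have h2 := hconv j
  have hρj : ρ ^ (j + 1) ≤ ρ ^ j := pow_le_pow_of_le_one hρ0 hρ1 (Nat.le_succ j)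
  have e : β (j + 1) (prefixOf gB (j + 1)) - β j (prefixOf gA j)
      = ((S.β0 (j + 1) - binf) - (S.β0 j - binf))
        + (S.β1 (j + 1) (prefixOf gB (j + 1)) - S.β1 j (prefixOf gA j)) := by
    rw [S.split (j + 1) (prefixOf gB (j + 1)), S.split j (prefixOf gA j)]; ring
  simp only [betaMismatch, remMismatch]
  rw [e]
  calc |(S.β0 (j + 1) - binf) - (S.β0 j - binf)
          + (S.β1 (j + 1) (prefixOf gB (j + 1)) - S.β1 j (prefixOf gA j))|
      ≤ |(S.β0 (j + 1) - binf) - (S.β0 j - binf)|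
          + |S.β1 (j + 1) (prefixOf gB (j + 1)) - S.β1 j (prefixOf gA j)| := abs_add_le _ _
    _ ≤ (|S.β0 (j + 1) - binf| + |S.β0 j - binf|)
          + |S.β1 (j + 1) (prefixOf gB (j + 1)) - S.β1 j (prefixOf gA j)| :=
        add_le_add (abs_sub _ _) le_rfl
    _ ≤ (c₀ * ρ ^ (j + 1) + c₀ * ρ ^ j)
          + |S.β1 (j + 1) (prefixOf gB (j + 1)) - S.β1 j (prefixOf gA j)| :=
        add_le_add (add_le_add h1 h2) le_rfl
    _ ≤ 2 * c₀ * ρ ^ j + |S.β1 (j + 1) (prefixOf gB (j + 1)) - S.β1 j (prefixOf gA j)| := by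
        nlinarith [mul_le_mul_of_nonneg_left hρj hc₀]

/-! ## §3 The located estimates of the two-trajectory technique TYPED, and the assembly -/

/-- READ-OUT (located estimate, NOT PRINTED — hypothesis shape): along the two runs, the β¹-mismatch of the partnered
steps is controlled by the discrepancy majorant `s_j` of the j-th matched pair of brackets, `remMismatch S gA gB j ≤ r·s_j`
for `j < K`.  Structural basis: β_{k+1} is read off the NEW term E^{(k+1)} by (1.20)/(1.22) — a linear functional (second
moment of the vacuum-polarization kernel) of that bracket — so `r` is the norm of the read-out in whatever norm `s`
majorises; no such norm or bound is printed. [cite: Balaban1987RG1, (1.20)-(1.22) p.264 and (2.15) p.268] -/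
def TwoRunReadOut {β : HBeta} (S : B12Beta.OneLoopSplit β) (r : ℝ) (gA gB : ℕ → ℝ) (s : ℕ → ℝ) (K : ℕ) : Prop :=
  ∀ j, j < K → remMismatch S gA gB j ≤ r * s j

/-- TWO-RUN RENEWAL (located estimate, NOT PRINTED — hypothesis shape): the discrepancy majorant of the j-th matched pair
of brackets obeys `s_j ≤ a ρ^j + ℓ'·|g^A_j − g^B_{j+1}| + Σ_{i<j} M_{j,i}·s_i` for `j < K` — (i) the η-rate of the
step's explicit objects (cell NE2/NE3) and B's unpartnered finest bracket as the source `aρ^j`, (ii) the discrepancy of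
the explicitly entering LAST couplings injected once, at birth, with modulus `ℓ'`, (iii) the older pairs' discrepancies
through the previous action in the curly bracket of (2.12), with memory `M` (to be paired with
`T4CouplingMatching.FadingMemory C ω M`).  The structural reading of (2.12)/(2.13); the inequality itself — a modulus of
continuity of one renormalization step with fading memory, along two runs — is printed nowhere ([III] p. 262 sets the
map formulation aside). [cite: Balaban1987RG1, (2.12)-(2.15) p.268 and (0.23) p.256] -/
def TwoRunRenewal (a ℓ' ρ : ℝ) (M : ℕ → ℕ → ℝ) (gA gB : ℕ → ℝ) (s : ℕ → ℝ) (K : ℕ) : Prop :=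
  ∀ j, j < K → s j ≤ a * ρ ^ j + ℓ' * |gA j - gB (j + 1)| + ∑ i ∈ range j, M j i * s i

/-- **NODE U2 BY TWO-TRAJECTORY COMPARISON (one pair of runs).**  Two runs of (0.20) for one history-dependent family
`β` (run A: K steps, run B: K + 1 steps), inside the box ]0, γ], infrared-pinned `g^A_K = g^B_{K+1}`; the printed
one-loop split `S` with the β sub-cell's (AF-0r) rate `hconv` (BetaPertH member, a binder); the located estimates
`TwoRunReadOut S r` and `TwoRunRenewal a ℓ' ρ M` along the two runs with `FadingMemory C ω M`, `(1 + C)ω < ρ < 1`; and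
the γ-window `r·ℓ'γ³·κ ≤ (1 − ρ)/2`, `κ = (ρ − ω)/(ρ − (1 + C)ω)`.  THEN, with `D_δ = 2(2c₀ + raκ)(1 − ρ)⁻¹` and
`D_s = (a + ℓ'γ³D_δ)κ` (free of K): `disc gA gB j ≤ D_δ ρ^j` for `j ≤ K` and `s_j ≤ D_s ρ^j` for `j < K`.
`twoPoint_fixedPoint` with `p = 2c₀`, `q = r`, `e_j = ℓ'(g^A_j)²g^B_{j+1} ≤ ℓ'γ³` (`abs_sub_le_of_inv_sq`).  Where
asymptotic freedom enters: NOWHERE in the matching (pointwise `g ≤ γ` suffices because `ω`-memory contracts faster than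
the rate `ρ`); it enters only the EXISTENCE of the pinned runs in the box (node U1/H3, binders here). [folklore] -/
theorem disc_le_of_twoRun {β : HBeta} (S : B12Beta.OneLoopSplit β) {K : ℕ} {gA gB s : ℕ → ℝ} {M : ℕ → ℕ → ℝ}
    {γ binf c₀ a ℓ' r C ω ρ : ℝ}
    (hρ1 : ρ < 1) (hω : 0 ≤ ω) (hC : 0 ≤ C) (hsmall : (1 + C) * ω < ρ)
    (hc₀ : 0 ≤ c₀) (ha : 0 ≤ a) (hℓ' : 0 ≤ ℓ') (hr : 0 ≤ r)
    (hA : RGEqH K β gA) (hB : RGEqH (K + 1) β gB)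
    (hAbox : ∀ i, i ≤ K → 0 < gA i ∧ gA i ≤ γ) (hBbox : ∀ i, i ≤ K + 1 → 0 < gB i ∧ gB i ≤ γ)
    (hpin : gA K = gB (K + 1))
    (hconv : ∀ k, |S.β0 k - binf| ≤ c₀ * ρ ^ k)
    (hread : TwoRunReadOut S r gA gB s K) (hren : TwoRunRenewal a ℓ' ρ M gA gB s K)
    (hs : ∀ j, j < K → 0 ≤ s j) (hM : FadingMemory C ω M)
    (hgain : r * (ℓ' * γ ^ 3) * ((ρ - ω) / (ρ - (1 + C) * ω)) ≤ (1 - ρ) / 2) :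
    (∀ j, j ≤ K → disc gA gB j ≤ 2 * (2 * c₀ + r * a * ((ρ - ω) / (ρ - (1 + C) * ω))) / (1 - ρ) * ρ ^ j) ∧
    (∀ j, j < K → s j ≤ (a + ℓ' * γ ^ 3 * (2 * (2 * c₀ + r * a * ((ρ - ω) / (ρ - (1 + C) * ω))) / (1 - ρ)))
      * ((ρ - ω) / (ρ - (1 + C) * ω)) * ρ ^ j) := by
  have h1Cω : 0 ≤ (1 + C) * ω := by positivity
  have hρ0 : 0 < ρ := lt_of_le_of_lt h1Cω hsmall
  have hγ : 0 < γ := lt_of_lt_of_le (hAbox 0 (Nat.zero_le K)).1 (hAbox 0 (Nat.zero_le K)).2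
  have hu : ∀ j, j < K →
      0 ≤ ℓ' * ((gA j) ^ 2 * gB (j + 1)) ∧ ℓ' * ((gA j) ^ 2 * gB (j + 1)) ≤ ℓ' * γ ^ 3 := by
    intro j hj
    have hgA := hAbox j hj.le
    have hgB := hBbox (j + 1) (by omega)
    have hcube : (gA j) ^ 2 * gB (j + 1) ≤ γ ^ 3 := by
      calc (gA j) ^ 2 * gB (j + 1) ≤ γ ^ 2 * γ :=
            mul_le_mul (pow_le_pow_left₀ hgA.1.le hgA.2 2) hgB.2 hgB.1.le (sq_nonneg γ)
        _ = γ ^ 3 := by ring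
    exact ⟨mul_nonneg hℓ' (mul_nonneg (sq_nonneg _) hgB.1.le), mul_le_mul_of_nonneg_left hcube hℓ'⟩
  have hback : ∀ j, j < K → disc gA gB j ≤ disc gA gB (j + 1) + 2 * c₀ * ρ ^ j + r * s j := by
    intro j hj
    have h1 := disc_step_twoRun hA hB hj
    have h2 := betaMismatch_le_split S hρ0.le hρ1.le hc₀ hconv gA gB j
    have h3 := hread j hj
    linarith
  have hfwd : ∀ j, j < K →
      s j ≤ a * ρ ^ j + ℓ' * ((gA j) ^ 2 * gB (j + 1)) * disc gA gB j + ∑ i ∈ range j, M j i * s i := by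
    intro j hj
    have h1 := hren j hj
    have hgA := hAbox j hj.le
    have hgB := hBbox (j + 1) (by omega)
    have h2 : ℓ' * |gA j - gB (j + 1)| ≤ ℓ' * ((gA j) ^ 2 * gB (j + 1)) * disc gA gB j := by
      rw [mul_assoc]
      exact mul_le_mul_of_nonneg_left (abs_sub_le_of_inv_sq hgA.1 hgB.1) hℓ'
    linarith
  exact twoPoint_fixedPoint (δ := disc gA gB) (e := fun j => ℓ' * ((gA j) ^ 2 * gB (j + 1)))
    (ē := ℓ' * γ ^ 3) (p := 2 * c₀) (q := r)
    hρ1 hω hC hsmall ha (by positivity) hr (by positivity) (disc_nonneg gA gB) hs hu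
    (fun j i hij => hM j i hij.le) (disc_pin hpin) hback hfwd hgain

/-- **THE β¹-MISMATCH RATE (node U2's NE4 in two-run form).**  Under the hypotheses of `disc_le_of_twoRun`, for every
`j < K`: `remMismatch S gA gB j ≤ r·D_s·ρ^j` (the β¹-halves of the partnered steps of the two runs differ geometrically
— the two-run, along-the-runs form of `T4CouplingMatching.RemainderShiftRate`) and `betaMismatch β gA gB j ≤
(2c₀ + r·D_s)·ρ^j` (the full form, cf. `ScaleShiftRate (2c₀ + c₁)` of `scaleShiftRate_of_split`), constants free of K.
This is what the technique was asked for: (AF-0r) in, β¹-mismatch rate out, conditionally on the two located estimates.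
[folklore] -/
theorem betaMismatch_rate_of_twoRun {β : HBeta} (S : B12Beta.OneLoopSplit β) {K : ℕ} {gA gB s : ℕ → ℝ}
    {M : ℕ → ℕ → ℝ} {γ binf c₀ a ℓ' r C ω ρ : ℝ}
    (hρ1 : ρ < 1) (hω : 0 ≤ ω) (hC : 0 ≤ C) (hsmall : (1 + C) * ω < ρ)
    (hc₀ : 0 ≤ c₀) (ha : 0 ≤ a) (hℓ' : 0 ≤ ℓ') (hr : 0 ≤ r)
    (hA : RGEqH K β gA) (hB : RGEqH (K + 1) β gB)
    (hAbox : ∀ i, i ≤ K → 0 < gA i ∧ gA i ≤ γ) (hBbox : ∀ i, i ≤ K + 1 → 0 < gB i ∧ gB i ≤ γ)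
    (hpin : gA K = gB (K + 1))
    (hconv : ∀ k, |S.β0 k - binf| ≤ c₀ * ρ ^ k)
    (hread : TwoRunReadOut S r gA gB s K) (hren : TwoRunRenewal a ℓ' ρ M gA gB s K)
    (hs : ∀ j, j < K → 0 ≤ s j) (hM : FadingMemory C ω M)
    (hgain : r * (ℓ' * γ ^ 3) * ((ρ - ω) / (ρ - (1 + C) * ω)) ≤ (1 - ρ) / 2) :
    ∀ j, j < K →
      remMismatch S gA gB j ≤ r * ((a + ℓ' * γ ^ 3 * (2 * (2 * c₀ + r * a * ((ρ - ω) / (ρ - (1 + C) * ω)))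
        / (1 - ρ))) * ((ρ - ω) / (ρ - (1 + C) * ω))) * ρ ^ j ∧
      betaMismatch β gA gB j ≤ (2 * c₀ + r * ((a + ℓ' * γ ^ 3 * (2 * (2 * c₀ + r * a *
        ((ρ - ω) / (ρ - (1 + C) * ω))) / (1 - ρ))) * ((ρ - ω) / (ρ - (1 + C) * ω)))) * ρ ^ j := by
  have h1Cω : 0 ≤ (1 + C) * ω := by positivity
  have hρ0 : 0 < ρ := lt_of_le_of_lt h1Cω hsmall
  have hmain := (disc_le_of_twoRun S hρ1 hω hC hsmall hc₀ ha hℓ' hr hA hB hAbox hBbox hpin hconv hread hren hs hM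
    hgain).2
  intro j hj
  have h1 : remMismatch S gA gB j ≤ r * ((a + ℓ' * γ ^ 3 * (2 * (2 * c₀ + r * a * ((ρ - ω) / (ρ - (1 + C) * ω)))
      / (1 - ρ))) * ((ρ - ω) / (ρ - (1 + C) * ω))) * ρ ^ j := by
    have h := mul_le_mul_of_nonneg_left (hmain j hj) hr
    calc remMismatch S gA gB j ≤ r * s j := hread j hj
      _ ≤ _ := by simpa [mul_assoc] using h
  refine ⟨h1, ?_⟩
  have h2 := betaMismatch_le_split S hρ0.le hρ1.le hc₀ hconv gA gB j
  calc betaMismatch β gA gB j ≤ 2 * c₀ * ρ ^ j + remMismatch S gA gB j := h2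
    _ ≤ 2 * c₀ * ρ ^ j + r * ((a + ℓ' * γ ^ 3 * (2 * (2 * c₀ + r * a * ((ρ - ω) / (ρ - (1 + C) * ω)))
      / (1 - ρ))) * ((ρ - ω) / (ρ - (1 + C) * ω))) * ρ ^ j := by linarith
    _ = _ := by ring

/-- **NODE U2's OUTPUT FROM THE TWO-RUN SYSTEM, K-UNIFORM.**  For every K let `g K` be the K-step run of (0.20) from
ε = L^{−K}, all inside the box ]0, γ] and all pinned at the renormalized value `g K K = gIR`; suppose the located
estimates hold for every consecutive pair (`g K`, `g (K+1)`) with data `s K`, `M K` and constants `a, ℓ', r, C, ω, ρ`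
FREE OF K, plus (AF-0r) and the γ-window.  Then the coupling discrepancies `δ^K_j = disc (g K) (g (K+1)) j` satisfy
`T4CauchySum.InjectedRate D_δ 0 ρ` (geometric rate, NO polynomial prefactor) — the input of nodes U4/U5
(`T4CauchySum`, `T4OutputRate`).  Bookkeeping over `disc_le_of_twoRun`. [folklore] -/
theorem injectedRate_of_twoRun_runs {β : HBeta} (S : B12Beta.OneLoopSplit β) (g : ℕ → ℕ → ℝ) (gIR : ℝ)
    {s : ℕ → ℕ → ℝ} {M : ℕ → ℕ → ℕ → ℝ} {γ binf c₀ a ℓ' r C ω ρ : ℝ}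
    (hρ1 : ρ < 1) (hω : 0 ≤ ω) (hC : 0 ≤ C) (hsmall : (1 + C) * ω < ρ)
    (hc₀ : 0 ≤ c₀) (ha : 0 ≤ a) (hℓ' : 0 ≤ ℓ') (hr : 0 ≤ r)
    (hrun : ∀ K, RGEqH K β (g K)) (hbox : ∀ K i, i ≤ K → 0 < g K i ∧ g K i ≤ γ) (hpin : ∀ K, g K K = gIR)
    (hconv : ∀ k, |S.β0 k - binf| ≤ c₀ * ρ ^ k)
    (hread : ∀ K, TwoRunReadOut S r (g K) (g (K + 1)) (s K) K)
    (hren : ∀ K, TwoRunRenewal a ℓ' ρ (M K) (g K) (g (K + 1)) (s K) K)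
    (hs : ∀ K j, j < K → 0 ≤ s K j) (hM : ∀ K, FadingMemory C ω (M K))
    (hgain : r * (ℓ' * γ ^ 3) * ((ρ - ω) / (ρ - (1 + C) * ω)) ≤ (1 - ρ) / 2) :
    T4CauchySum.InjectedRate (2 * (2 * c₀ + r * a * ((ρ - ω) / (ρ - (1 + C) * ω))) / (1 - ρ)) 0 ρ
      (fun K j => disc (g K) (g (K + 1)) j) := by
  intro K j hj
  refine ⟨disc_nonneg _ _ _, ?_⟩
  have h := (disc_le_of_twoRun S hρ1 hω hC hsmall hc₀ ha hℓ' hr (hrun K) (hrun (K + 1)) (hbox K) (hbox (K + 1))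
    ((hpin K).trans (hpin (K + 1)).symm) hconv (hread K) (hren K) (hs K) (hM K) hgain).1 j hj
  simpa using h

/-- DEGENERATE CONSISTENCY CHECK (non-vacuity of the hypothesis SET given the runs): for a pure one-loop family (`β¹ ≡ 0`)
the located estimates hold trivially with `s ≡ 0`, `M ≡ 0`, `a = ℓ' = r = C = ω = 0`, and the joint system collapses to
`backward_geom` driven by (AF-0r) alone: `disc gA gB j ≤ 4c₀(1 − ρ)⁻¹ρ^j`.  (ρ > 0 is needed only to instantiate the
strict memory gap `(1 + C)ω < ρ`.) [folklore] -/
theorem disc_le_of_pureOneLoop {β : HBeta} (S : B12Beta.OneLoopSplit β) {K : ℕ} {gA gB : ℕ → ℝ}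
    {γ binf c₀ ρ : ℝ} (hρ0 : 0 < ρ) (hρ1 : ρ < 1) (hc₀ : 0 ≤ c₀)
    (hA : RGEqH K β gA) (hB : RGEqH (K + 1) β gB)
    (hAbox : ∀ i, i ≤ K → 0 < gA i ∧ gA i ≤ γ) (hBbox : ∀ i, i ≤ K + 1 → 0 < gB i ∧ gB i ≤ γ)
    (hpin : gA K = gB (K + 1))
    (hconv : ∀ k, |S.β0 k - binf| ≤ c₀ * ρ ^ k) (h1 : ∀ k p, S.β1 k p = 0) :
    ∀ j, j ≤ K → disc gA gB j ≤ 4 * c₀ / (1 - ρ) * ρ ^ j := by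
  have hread : TwoRunReadOut S 0 gA gB (fun _ => 0) K := fun j _ => by simp [remMismatch, h1]
  have hren : TwoRunRenewal 0 0 ρ (fun _ _ => 0) gA gB (fun _ => 0) K := fun j _ => by simp
  have hs : ∀ j, j < K → (0 : ℝ) ≤ (fun _ => (0 : ℝ)) j := fun _ _ => le_rfl
  have hM : FadingMemory 0 0 (fun _ _ => (0 : ℝ)) := fun k i _ => by simp
  have hsmall : (1 + (0 : ℝ)) * 0 < ρ := by simpa using hρ0
  have hgain : (0 : ℝ) * (0 * γ ^ 3) * ((ρ - 0) / (ρ - (1 + 0) * 0)) ≤ (1 - ρ) / 2 := by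
    rw [zero_mul, zero_mul]; linarith
  have h := (disc_le_of_twoRun S hρ1 le_rfl le_rfl hsmall hc₀ le_rfl le_rfl le_rfl hA hB hAbox hBbox hpin hconv
    hread hren hs hM hgain).1
  have e : 2 * (2 * c₀ + 0 * 0 * ((ρ - 0) / (ρ - (1 + 0) * 0))) / (1 - ρ) = 4 * c₀ / (1 - ρ) := by ring
  intro j hj
  have hj' := h j hj
  rw [e] at hj'
  exact hj'

end Literature.MathematicalPhysics.QuantumFieldTheory.Balaban1983to89.T4TwoRunMatching
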